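import Summits.ResolutionOfSingularities.ResolutionOfSingularities.Theorems.FrobeniusClosingSteerSteeredExit
import Summits.ResolutionOfSingularities.ResolutionOfSingularities.Theorems.ValuativeLuAlphaPTorsorChartRegular
import Mathlib.RingTheory.Ideal.Height
import Mathlib.RingTheory.AlgebraicIndependent.TranscendenceBasis
import Mathlib.RingTheory.Algebraic.Integral
import HarnessLib

/-!
# Crux `Steer` (stmt-ResolutionOfSingularities-16345), chain W4.1, R2 σ_top line: **member dimension**
# (the members of a tower of local blowings up of the core local ring have Krull dimension EXACTLY `n`,
# so a non-maximal prime of a member has height `≤ n − 1`; Theses-free body)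

OURS (campaign `res-hironaka`, rung L ★L-G4, slot W4.1, chain W4.1; seat `res-type-022` on the ORDER of
`res-L0-w41-plan-1` 2026-08-27T05:27:52Z, kernels (K-T1)/(K-T2); replaces the role of no printed item; NOT a
statement of the manuscript under review; AI review is weaker than expert review). SIBLING of
`FrobeniusClosingSteerTailCodimBound.lean` (res-L0-w41-lead-1, p502821: the INEQUALITY
`dim (A₁)_{𝔪_O ∩ A₁} ≤ trdeg_k K` and the snippet's `TailCodimBound` by name); this file adds the EQUALITY
`dim (R N) = n` under the zero-dimensionality of `O` (the dimension junction consumed by the HDEG glue of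
`stub_logFinalExitM` and by G4), as asked in lead-1's DE-COLLISION line 2026-08-27T05:50:18Z (option (b)):

* (K-T2) `TailCodim.height_add_one_le` — in a local ring of Krull dimension `n`, a prime ideal `P ≠ 𝔪` has
  `height P + 1 ≤ n` (`P < 𝔪` and `height 𝔪 = dim`); `TailCodim.codim_add_one_le` is the `ℕ`-valued form
  used by the snippet's `IsDominantTail` (`(P i).height = c`, `P i ≠ 𝔪`).
* (K-T1) `TailCodim.ringKrullDim_member_eq` — for fields `k ⊆ K`, a valuation ring `O` of `K` which is
  ZERO-DIMENSIONAL over `k` (every `x ∈ O` satisfies `f(x) ∈ 𝔪_O` for some non-zero `f ∈ k[X]`), a finitely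
  generated `k`-subalgebra `A₀ ⊆ O`, `t ∈ K` with `t ^ p ∈ A₀` (`p ≥ 1`) and `Frac (k[A₀, t]) = K`, and
  `trdeg_k K = n`: every member `R N` of a tower of local blowings up (Novacoski–Spivakovsky Def. 2.8) with
  respect to `O` starting at `R 0 = (A₀)_{𝔪_O ∩ A₀}` has `dim (R N) = n` (`TailCodim.ringKrullDim_locAtCentre_eq` is
  the model form `dim (A₁)_{𝔪_O ∩ A₁} = dim A₁`); `TailCodim.height_add_one_le_member` /
  `TailCodim.codim_add_one_le_member` combine the two.

## Proof of (K-T1)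

`R N = (A₁)_{𝔪_O ∩ A₁}` for a finitely generated model `A₀ ≤ A₁ ⊆ O` (`SteeredExit.exists_model_of_tower`,
landed p497302). `K` is ALGEBRAIC over `A₁`: `k[A₀, t]` is integral over `A₁` (`A₀ ⊆ A₁`, `t ^ p ∈ A₁`) and
`K` is its field of fractions (`TailCodim.isAlgebraic_of_adjoin_isFractionRing`); hence
`trdeg_k A₁ = trdeg_k K = n` (`trdeg_add_eq`, `trdeg_eq_zero`), so `dim A₁ = n` (`dim = trdeg` for affine
domains, Matsumura Thm. 5.6, tree `exists_ringKrullDim_eq_and_trdeg_eq`). The centre `𝔪_O ∩ A₁` is a MAXIMAL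
ideal because `O` is zero-dimensional over `k` (tree `isMaximal_centre_of_zeroDim`), and affine domains are
equidimensional at closed points (tree `ringKrullDim_localization_atPrime_eq_of_isMaximal`), so
`dim (A₁)_{𝔪_O ∩ A₁} = dim A₁ = n`; transport along `locAtCentreEquiv`.
[cite: NovacoskiSpivakovsky2014, Def. 2.8 and Lemma 2.9] [cite: Matsumura1987, Thm. 5.6] [folklore]
-/

noncomputable section

-- `Summit.<S>.<S>.…` duplicates the summit name by design (single-problem summit).
set_option linter.dupNamespace false

open IsLocalRing

namespace Summit.ResolutionOfSingularities.ResolutionOfSingularities.Theorems.SwitchingDichotomy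

open Literature.AlgebraicGeometry.Resolution
open Summit.ResolutionOfSingularities.ResolutionOfSingularities.Theorems.PfaffLine
  (isMaximal_centre_of_zeroDim)

namespace TailCodim

/-! ## (K-T2) Height bound for non-maximal primes of a local ring -/

/-- **(K-T2) Height bound.** In a local ring `S` of Krull dimension `n`, a prime ideal `P` other than the
maximal ideal has `height P + 1 ≤ n`: `P < 𝔪` gives `height P + 1 ≤ height 𝔪 = dim S`. (No Noetherian
hypothesis is needed.) OURS. [folklore] -/
theorem height_add_one_le (S : Type*) [CommRing S] [IsLocalRing S] (P : Ideal S) [P.IsPrime]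
    (hP : P ≠ maximalIdeal S) (n : ℕ) (hdim : ringKrullDim S = n) : P.height + 1 ≤ n := by
  have hlt : P < maximalIdeal S :=
    lt_of_le_of_ne (IsLocalRing.le_maximalIdeal (Ideal.IsPrime.ne_top ‹_›)) hP
  have h1 : P.height + 1 ≤ (maximalIdeal S).height := Ideal.height_add_one_le_of_lt_of_isPrime hlt
  have h2 : ((maximalIdeal S).height : WithBot ℕ∞) = n := by
    rw [IsLocalRing.maximalIdeal_height_eq_ringKrullDim, hdim]
  have h3 : (maximalIdeal S).height = n := by exact_mod_cast h2
  rw [h3] at h1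
  exact h1

/-- The `ℕ`-valued form of (K-T2): if moreover `height P = c` for a natural number `c`, then `c + 1 ≤ n`
(the shape consumed by the snippet's `IsDominantTail`: `(P i).height = c`, `P i ≠ 𝔪`). OURS. [folklore] -/
theorem codim_add_one_le (S : Type*) [CommRing S] [IsLocalRing S] (P : Ideal S) [P.IsPrime]
    (hP : P ≠ maximalIdeal S) (n : ℕ) (hdim : ringKrullDim S = n) (c : ℕ) (hc : P.height = c) :
    c + 1 ≤ n := by
  have h := height_add_one_le S P hP n hdim
  rw [hc] at h
  exact_mod_cast h

/-! ## (K-T1) Krull dimension of the members of a tower of local blowings up -/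

variable {k K : Type} [Field k] [Field K] [Algebra k K]

/-- **`K` is algebraic over every subalgebra between `A₀` and `K`** when `K = Frac (k[A₀, t])` with
`t ^ p ∈ A₀`, `p ≥ 1`: the generators of `k[A₀, t]` are integral over `A₁ ⊇ A₀`, and a quotient of algebraic
elements of the field `K` is algebraic (`A₁` is a domain). OURS. [folklore] -/
theorem isAlgebraic_of_adjoin_isFractionRing (A₀ A₁ : Subalgebra k K) (h01 : A₀ ≤ A₁) {t : K}
    {p : ℕ} (hp : 0 < p) (htp : t ^ p ∈ A₀)
    (hfr : IsFractionRing (Algebra.adjoin k (insert t (A₀ : Set K))) K) :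
    Algebra.IsAlgebraic A₁ K := by
  haveI := hfr
  -- every element of `B = k[A₀, t]` is integral over `A₁`
  have hle : Algebra.adjoin k (insert t (A₀ : Set K)) ≤
      (integralClosure A₁ K).restrictScalars k := by
    refine Algebra.adjoin_le ?_
    intro x hx
    change IsIntegral A₁ x
    rcases hx with rfl | hx
    · exact IsIntegral.of_pow hp (isIntegral_algebraMap (x := (⟨x ^ p, h01 htp⟩ : A₁)))
    · exact isIntegral_algebraMap (x := (⟨x, h01 hx⟩ : A₁))
  have hint : ∀ b : K, b ∈ Algebra.adjoin k (insert t (A₀ : Set K)) → IsIntegral A₁ b :=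
    fun b hb => hle hb
  refine ⟨fun z => ?_⟩
  obtain ⟨b, c, -, rfl⟩ := IsFractionRing.div_surjective (A := Algebra.adjoin k (insert t (A₀ : Set K))) z
  rw [div_eq_mul_inv]
  exact ((hint _ b.2).isAlgebraic).mul ((hint _ c.2).isAlgebraic.inv)

/-- Hence **`trdeg_k A₁ = trdeg_k K`** for every subalgebra `A₀ ≤ A₁` (`trdeg_k K = trdeg_k A₁ + trdeg_{A₁} K`
and the second summand vanishes). OURS. [folklore] -/
theorem trdeg_eq_of_model (A₀ A₁ : Subalgebra k K) (h01 : A₀ ≤ A₁) {t : K} {p : ℕ} (hp : 0 < p)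
    (htp : t ^ p ∈ A₀) (hfr : IsFractionRing (Algebra.adjoin k (insert t (A₀ : Set K))) K) :
    Algebra.trdeg k A₁ = Algebra.trdeg k K := by
  haveI := isAlgebraic_of_adjoin_isFractionRing A₀ A₁ h01 hp htp hfr
  haveI : FaithfulSMul k A₁ :=
    (faithfulSMul_iff_algebraMap_injective k A₁).mpr (algebraMap k A₁).injective
  haveI : FaithfulSMul A₁ K :=
    (faithfulSMul_iff_algebraMap_injective A₁ K).mpr Subtype.val_injective
  have h := trdeg_add_eq k A₁ (A := K)
  rw [trdeg_eq_zero (R := A₁) (A := K), add_zero] at h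
  exact h

/-- **`dim A₁ = n`** for a finitely generated subalgebra `A₀ ≤ A₁ ⊆ K` when `trdeg_k K = n`
(`K = Frac (k[A₀, t])`, `t ^ p ∈ A₀`): `dim A₁ = trdeg_k A₁` (Matsumura Thm. 5.6) `= trdeg_k K`.
OURS. [cite: Matsumura1987, Thm. 5.6] -/
theorem ringKrullDim_eq_of_model (A₀ A₁ : Subalgebra k K) (h01 : A₀ ≤ A₁) {t : K} {p : ℕ}
    (hp : 0 < p) (htp : t ^ p ∈ A₀)
    (hfr : IsFractionRing (Algebra.adjoin k (insert t (A₀ : Set K))) K) (hfg : A₁.FG) {n : ℕ}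
    (htr : Algebra.trdeg k K = (n : Cardinal)) : ringKrullDim A₁ = n := by
  haveI : Algebra.FiniteType k A₁ := A₁.fg_iff_finiteType.mp hfg
  obtain ⟨n', hn', htr'⟩ := exists_ringKrullDim_eq_and_trdeg_eq k A₁
  have h1 : (n' : Cardinal) = n := by
    rw [← htr', trdeg_eq_of_model A₀ A₁ h01 hp htp hfr, htr]
  have h2 : n' = n := by exact_mod_cast h1
  rw [hn', h2]

/-- **The local ring of a finitely generated `A₁ ⊆ O` at the centre of a zero-dimensional valuation ring
has dimension `dim A₁`**: the centre `𝔪_O ∩ A₁` is a maximal ideal (`isMaximal_centre_of_zeroDim`) and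
affine domains are equidimensional at closed points (`ringKrullDim_localization_atPrime_eq_of_isMaximal`).
OURS. [cite: Matsumura1987, §5 Thm. 5.6 and Ex. 5.1] -/
theorem ringKrullDim_centre_eq (O : ValuationSubring K)
    (hzd : ∀ x ∈ O, ∃ f : Polynomial k, f ≠ 0 ∧ Polynomial.aeval x f ∈ O.nonunits)
    (A₁ : Subalgebra k K) (h₁ : A₁.toSubring ≤ O.toSubring) (hfg : A₁.FG) {n : ℕ}
    (hdim : ringKrullDim A₁ = n) :
    ringKrullDim (Localization.AtPrime
      (Ideal.comap (Subring.inclusion h₁) (maximalIdeal O))) = n := by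
  haveI : (Ideal.comap (Subring.inclusion h₁) (maximalIdeal O)).IsMaximal :=
    isMaximal_centre_of_zeroDim O hzd A₁ h₁
  letI : Algebra k A₁.toSubring := A₁.algebra
  haveI : Algebra.FiniteType k A₁.toSubring := A₁.fg_iff_finiteType.mp hfg
  rw [ringKrullDim_localization_atPrime_eq_of_isMaximal k
    (Ideal.comap (Subring.inclusion h₁) (maximalIdeal O))]
  exact hdim

/-- **`dim (A₁)_{𝔪_O ∩ A₁} = n` inside `K`** (the `locAtCentre` form; the EQUALITY twin of
`TailCodim.ringKrullDim_locAtCentre_le` of `FrobeniusClosingSteerTailCodimBound.lean`, available under the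
zero-dimensionality of `O`). OURS. [cite: Matsumura1987, §5 Thm. 5.6 and Ex. 5.1] -/
theorem ringKrullDim_locAtCentre_eq (O : ValuationSubring K)
    (hzd : ∀ x ∈ O, ∃ f : Polynomial k, f ≠ 0 ∧ Polynomial.aeval x f ∈ O.nonunits)
    (A₁ : Subalgebra k K) (h₁ : A₁.toSubring ≤ O.toSubring) (hfg : A₁.FG) {n : ℕ}
    (hdim : ringKrullDim A₁ = n) : ringKrullDim (locAtCentre A₁.toSubring O) = n := by
  rw [ringKrullDim_eq_of_ringEquiv (locAtCentreEquiv h₁).toRingEquiv.symm]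
  exact ringKrullDim_centre_eq O hzd A₁ h₁ hfg hdim

/-- **(K-T1) Member dimension.** For fields `k ⊆ K`, a valuation ring `O` of `K` zero-dimensional over
`k`, a finitely generated `k`-subalgebra `A₀ ⊆ O`, `t ∈ K` with `t ^ p ∈ A₀` (`p ≥ 1`) and
`Frac (k[A₀, t]) = K`, and `trdeg_k K = n`: every member `R N` of a tower of local blowings up with respect
to `O` (Novacoski–Spivakovsky Def. 2.8) starting at `R 0 = (A₀)_{𝔪_O ∩ A₀}` has Krull dimension `n` — it is
the local ring at the (closed) centre of a finitely generated model `A₀ ≤ A₁ ⊆ O`. OURS.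
[cite: NovacoskiSpivakovsky2014, Def. 2.8 and Lemma 2.9] [cite: Matsumura1987, Thm. 5.6] -/
theorem ringKrullDim_member_eq (k K : Type) [Field k] [Field K] [Algebra k K]
    (O : ValuationSubring K) (A₀ : Subalgebra k K) (h₀ : A₀.toSubring ≤ O.toSubring) (t : K)
    {p : ℕ} (hp : 0 < p) (hfg : A₀.FG) (htp : t ^ p ∈ A₀)
    (hfr : IsFractionRing (Algebra.adjoin k (insert t (A₀ : Set K))) K)
    (h0 : ∀ x ∈ O, ∃ f : Polynomial k, f ≠ 0 ∧ Polynomial.aeval x f ∈ O.nonunits)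
    {n : ℕ} (htr : Algebra.trdeg k K = (n : Cardinal))
    (R : ℕ → Subring K) (N : ℕ) (hR0 : R 0 = locAtCentre A₀.toSubring O)
    (hst : ∀ i < N, IsLocalBlowup O (R i) (R (i + 1))) : ringKrullDim (R N) = n := by
  obtain ⟨A₁, h₁, h01, hfg₁, hRN⟩ := SteeredExit.exists_model_of_tower O A₀ h₀ hfg hR0 hst
  have hdimA₁ : ringKrullDim A₁ = n := ringKrullDim_eq_of_model A₀ A₁ h01 hp htp hfr hfg₁ htr
  rw [← hRN]
  exact ringKrullDim_locAtCentre_eq O h0 A₁ h₁ hfg₁ hdimA₁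

/-- **(K-T1) + (K-T2), `ℕ∞` form**: under the hypotheses of `ringKrullDim_member_eq`, a prime ideal `P ≠ 𝔪` of
the (local) member `R N` has `height P + 1 ≤ n`. OURS. [folklore] -/
theorem height_add_one_le_member (k K : Type) [Field k] [Field K] [Algebra k K]
    (O : ValuationSubring K) (A₀ : Subalgebra k K) (h₀ : A₀.toSubring ≤ O.toSubring) (t : K)
    {p : ℕ} (hp : 0 < p) (hfg : A₀.FG) (htp : t ^ p ∈ A₀)
    (hfr : IsFractionRing (Algebra.adjoin k (insert t (A₀ : Set K))) K)
    (h0 : ∀ x ∈ O, ∃ f : Polynomial k, f ≠ 0 ∧ Polynomial.aeval x f ∈ O.nonunits)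
    {n : ℕ} (htr : Algebra.trdeg k K = (n : Cardinal))
    (R : ℕ → Subring K) (N : ℕ) (hR0 : R 0 = locAtCentre A₀.toSubring O)
    (hst : ∀ i < N, IsLocalBlowup O (R i) (R (i + 1)))
    [IsLocalRing (R N)] (P : Ideal (R N)) [P.IsPrime] (hP : P ≠ maximalIdeal (R N)) :
    P.height + 1 ≤ n :=
  height_add_one_le (R N) P hP n
    (ringKrullDim_member_eq k K O A₀ h₀ t hp hfg htp hfr h0 htr R N hR0 hst)

/-- **(K-T1) + (K-T2): the codimension bound for a member.** Under the hypotheses of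
`ringKrullDim_member_eq`, a prime ideal `P ≠ 𝔪` of the (local) member `R N` with `height P = c` has
`c + 1 ≤ n` — the content of the snippet's `TailCodimBound` once `IsSteeredRun`/`IsDominantTail` are
unpacked (each steered step is a local blowing up, `IsLocalBlowupAlong.isLocalBlowup`). OURS. [folklore] -/
theorem codim_add_one_le_member (k K : Type) [Field k] [Field K] [Algebra k K]
    (O : ValuationSubring K) (A₀ : Subalgebra k K) (h₀ : A₀.toSubring ≤ O.toSubring) (t : K)
    {p : ℕ} (hp : 0 < p) (hfg : A₀.FG) (htp : t ^ p ∈ A₀)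
    (hfr : IsFractionRing (Algebra.adjoin k (insert t (A₀ : Set K))) K)
    (h0 : ∀ x ∈ O, ∃ f : Polynomial k, f ≠ 0 ∧ Polynomial.aeval x f ∈ O.nonunits)
    {n : ℕ} (htr : Algebra.trdeg k K = (n : Cardinal))
    (R : ℕ → Subring K) (N : ℕ) (hR0 : R 0 = locAtCentre A₀.toSubring O)
    (hst : ∀ i < N, IsLocalBlowup O (R i) (R (i + 1)))
    [IsLocalRing (R N)] (P : Ideal (R N)) [P.IsPrime] (hP : P ≠ maximalIdeal (R N))
    (c : ℕ) (hc : P.height = c) : c + 1 ≤ n :=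
  codim_add_one_le (R N) P hP n
    (ringKrullDim_member_eq k K O A₀ h₀ t hp hfg htp hfr h0 htr R N hR0 hst) c hc

end TailCodim

end Summit.ResolutionOfSingularities.ResolutionOfSingularities.Theorems.SwitchingDichotomy

end
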